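import Summits.HodgeConjecture.HodgeConjecture.Theses.LinearSystemTorelli
import Literature.AlgebraicGeometry.HodgeTheory.MiddleDimensionReductionOfHodgeModels
import Literature.AlgebraicGeometry.HodgeTheory.MiddleDimensionReductionHolds
import Literature.AlgebraicGeometry.HodgeTheory.HypersurfaceSectionLefschetz
import Literature.AlgebraicGeometry.HodgeTheory.SupportedClassesHodgeConiveau
import Literature.AlgebraicGeometry.HodgeTheory.AlgebraicClassesCup
import Literature.AlgebraicGeometry.HodgeTheory.AmbientClassesMoving
import Literature.AlgebraicGeometry.HodgeTheory.HypersurfaceLefschetzUpper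
import Literature.AlgebraicGeometry.HodgeTheory.GysinBaseChange
import Literature.AlgebraicGeometry.HodgeTheory.ComplexGysinRational
import Literature.AlgebraicGeometry.HodgeTheory.RationalClassesRingChange
import Literature.AlgebraicGeometry.HodgeTheory.GysinHodgeClassLiftProofs
import Literature.AlgebraicGeometry.Motives.UniversalHyperplaneSection
import Literature.AlgebraicGeometry.Motives.ProjectiveSpaceFieldPointsBijective
import Literature.AlgebraicGeometry.Motives.ComplexPointsOpenDense
import Literature.AlgebraicGeometry.Motives.VarietiesGeometricallyIntegralProofs
import Literature.Topology.FourManifolds.ComplexProjectiveSpaceHomologyProofs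
import Summits.HodgeConjecture.HodgeConjecture.Theorems.PadicSemiregularLiftHodgeBeyondAnchorsProductsNotAnchors
import Summits.HodgeConjecture.HodgeConjecture.Theorems.LinearSystemTorelliPencilReductionTopology

/-!
# Route LinearSystemTorelli — `PencilReduction` (item stmt-HodgeConjecture-1083): the push-forward formula

Helper file of the conditional assembly `LinearSystemTorelliPencilReduction`. For the incidence situation
`emb : 𝒴 ↪ X × P` (`P = (ℙᴺ)^*`, `N = N' + 1`), a slice `s_t : X → X × P`, a class `θ ∈ H^{2N'}(P(ℂ))`
with `q_* f^* θ = λ • 1` (`q = emb ≫ pr₁`, `f = emb ≫ pr₂`), and a class `ζ̃ ∈ H²ᵖ((X × P)(ℂ))` with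
`s_t^* ζ̃ = c`, the Gysin calculus of the tree (`complexGysin`: functoriality, projection formula,
Thom–Gysin exactness for the slice, Künneth spanning, `H¹(P(ℂ)) = 0`) gives

  `pr_{1*} emb_* (emb^*(pr₂^* θ) ∪ emb^* ζ̃) = λ • c + s_t^*[𝒴] ∪ A₁`,
  `A₁ = pr_{1*}(pr₂^* θ ∪ (ζ̃ − pr₁^* c))`,

the key step being LEMMA K: `pr₂^*θ ∪ δ = s_{t*} pr_{1*}(pr₂^*θ ∪ δ)` for every `δ` with `s_t^* δ = 0`
(expand `δ` in Künneth generators `pr₁^* a ∪ pr₂^* b`; the generators with `deg b = 0` sum to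
`pr₁^* s_t^* δ = 0`, those with `deg b = 1` vanish, with `deg b = 2` are slice classes, and with
`deg b ≥ 3` die for degree reasons). Everything is proved.
-/

noncomputable section

open scoped Manifold ContDiff
open CategoryTheory CategoryTheory.Limits AlgebraicGeometry MonoidalCategory CartesianMonoidalCategory
open Literature.AlgebraicTopology.SingularHomology
open Literature.AlgebraicGeometry Literature.AlgebraicGeometry.Motives Literature.AlgebraicGeometry.HodgeTheory

set_option linter.dupNamespace false

namespace Summit.HodgeConjecture.HodgeConjecture.Theorems

/-- **The push-forward formula of the incidence-divisor proof** (module docstring):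
`pr_{1*} emb_* (emb^*(pr₂^* θ) ∪ emb^* ζ̃) = λ • c + s_t^*[𝒴] ∪ pr_{1*}(pr₂^* θ ∪ (ζ̃ − pr₁^* c))` whenever
`s_t^* ζ̃ = c` and `q_* f^* θ = λ • 1`. [cite: FultonYoungTableaux1997, Appendix B §B.1 (5)–(6)]
[cite: VoisinHodgeII2003, §6.1.1] [cite: HatcherAT2002, §3.2 Thm. 3.16] -/
theorem pushforward_incidence_formula (μ : OrientationFamily) {m p N N' : ℕ} (hN' : N = N' + 1) (hp : 1 ≤ p)
    {X Y : SchemeOver ℂ} (hX : IsSmoothProjective (m + 1) X)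
    (hP : IsSmoothProjective N (dualProjectiveSpace N ℂ))
    (hXP : IsSmoothProjective (m + 1 + N) (X ⊗ dualProjectiveSpace N ℂ))
    (hY : IsSmoothProjective (m + N) Y) (emb : Y ⟶ X ⊗ dualProjectiveSpace N ℂ) [IsClosedImmersion emb.left]
    (t : ComplexPoints (dualProjectiveSpace N ℂ)) [IsClosedImmersion (sliceAt X t).left]
    (θ : complexBetti (dualProjectiveSpace N ℂ) (2 * N')) (ζt : complexBetti (X ⊗ dualProjectiveSpace N ℂ) (2 * p))
    (c : complexBetti X (2 * p)) (hct : complexBetti.map (sliceAt X t) (2 * p) ζt = c) (lam : ℂ)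
    (hlam : complexGysin μ hY hX (emb ≫ fst X (dualProjectiveSpace N ℂ))
      (show 2 * N' + 2 * (m + 1) = 0 + 2 * (m + N) by omega)
      (complexBetti.map (emb ≫ snd X (dualProjectiveSpace N ℂ)) (2 * N') θ) = lam • singularCohomology.one ℂ _) :
    complexGysin μ hXP hX (fst X (dualProjectiveSpace N ℂ))
      (show 2 * (N' + p + 1) + 2 * (m + 1) = 2 * p + 2 * (m + 1 + N) by omega)
      (complexGysin μ hY hXP emb (show (2 * N' + 2 * p) + 2 * (m + 1 + N) = 2 * (N' + p + 1) + 2 * (m + N) by omega)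
        (cupProduct rfl (complexBetti.map emb (2 * N')
          (complexBetti.map (snd X (dualProjectiveSpace N ℂ)) (2 * N') θ)) (complexBetti.map emb (2 * p) ζt))) =
    lam • c + cupProduct (show 2 + 2 * (p - 1) = 2 * p by omega)
      (complexBetti.map (sliceAt X t) 2 (complexGysin μ hY hXP emb
        (show 0 + 2 * (m + 1 + N) = 2 + 2 * (m + N) by omega) (singularCohomology.one ℂ _)))
      (complexGysin μ hXP hX (fst X (dualProjectiveSpace N ℂ))
        (show (2 * N' + 2 * p) + 2 * (m + 1) = 2 * (p - 1) + 2 * (m + 1 + N) by omega)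
        (cupProduct rfl (complexBetti.map (snd X (dualProjectiveSpace N ℂ)) (2 * N') θ)
          (ζt - complexBetti.map (fst X (dualProjectiveSpace N ℂ)) (2 * p) c))) := by
  have hμ : μ.HasPoincareDuality := OrientationFamily.hasPoincareDuality μ
  haveI := pathConnectedSpace_complexPoints hX
  set Θ : complexBetti (X ⊗ (dualProjectiveSpace N ℂ)) (2 * N') := complexBetti.map (snd X (dualProjectiveSpace N ℂ)) (2 * N') θ with hΘdef
  set δ : complexBetti (X ⊗ (dualProjectiveSpace N ℂ)) (2 * p) := ζt - complexBetti.map (fst X (dualProjectiveSpace N ℂ)) (2 * p) c with hδdef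
  set A₁ : complexBetti X (2 * (p - 1)) := complexGysin μ hXP hX (fst X (dualProjectiveSpace N ℂ))
    (show (2 * N' + 2 * p) + 2 * (m + 1) = 2 * (p - 1) + 2 * (m + 1 + N) by omega)
    (cupProduct rfl Θ δ) with hA₁def
  set Ycl : complexBetti (X ⊗ (dualProjectiveSpace N ℂ)) 2 := complexGysin μ hY hXP emb
    (show 0 + 2 * (m + 1 + N) = 2 + 2 * (m + N) by omega) (singularCohomology.one ℂ _) with hYcldef
  set W : complexBetti (X ⊗ (dualProjectiveSpace N ℂ)) (2 * (N' + p + 1)) := complexGysin μ hY hXP emb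
    (show (2 * N' + 2 * p) + 2 * (m + 1 + N) = 2 * (N' + p + 1) + 2 * (m + N) by omega)
    (cupProduct rfl (complexBetti.map emb (2 * N') Θ) (complexBetti.map emb (2 * p) ζt)) with hWdef
  have hδt : complexBetti.map (sliceAt X t) (2 * p) δ = 0 := by
    rw [hδdef, map_sub, hct, ← CategoryTheory.comp_apply, ← complexBetti.map_comp, sliceAt_fst,
      complexBetti.map_id, CategoryTheory.id_apply, sub_self]
  have hpr : 2 * (N' + p + 1) + 2 * (m + 1) = 2 * p + 2 * (m + 1 + N) := by omega
  have h1 : (2 * N' + 2 * p) + 2 = 2 * (N' + p + 1) := by omega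
  have h1' : 2 + (2 * N' + 2 * p) = 2 * (N' + p + 1) := by omega
  have h9 : 2 + 2 * (p - 1) = 2 * p := by omega
  -- LEMMA K: `Θ ∪ δ` is the Gysin image of `A₁ = pr_{1*}(Θ ∪ δ)` under the slice `s_t`
  have hK : cupProduct rfl Θ δ = complexGysin μ hX hXP (sliceAt X t)
      (show 2 * (p - 1) + 2 * (m + 1 + N) = (2 * N' + 2 * p) + 2 * (m + 1) by omega) A₁ := by
    -- `pr_{1*} s_{t*} = 𝟙` in every degree
    have hps : ∀ {i k : ℕ} (hi : i + 2 * (m + 1 + N) = k + 2 * (m + 1))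
        (hi' : k + 2 * (m + 1) = i + 2 * (m + 1 + N)) (y : complexBetti X i),
        complexGysin μ hXP hX (fst X (dualProjectiveSpace N ℂ)) hi' (complexGysin μ hX hXP (sliceAt X t) hi y) = y := by
      intro i k hi hi' y
      rw [← LinearMap.comp_apply, ← complexGysin_comp hμ hX hXP hX (sliceAt X t) (fst X (dualProjectiveSpace N ℂ))]
      simp only [sliceAt_fst]
      rw [complexGysin_id hμ hX, LinearMap.id_apply]
    -- the top-degree classes of `(dualProjectiveSpace N ℂ)` pull back to multiples of the slice class `s_{t*} 1` (Thom–Gysin)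
    have htop : ∀ ρ : complexBetti (dualProjectiveSpace N ℂ) (2 * N' + 2), ∃ κ : ℂ, complexBetti.map (snd X (dualProjectiveSpace N ℂ)) (2 * N' + 2) ρ =
        κ • complexGysin μ hX hXP (sliceAt X t) (show 0 + 2 * (m + 1 + N) = (2 * N' + 2) + 2 * (m + 1) by omega)
          (singularCohomology.one ℂ _) := by
      intro ρ
      have hP' : IsSmoothProjective (N' + 1) (dualProjectiveSpace N ℂ) := by rw [← hN']; exact hP
      have hρsupp : complexBetti.restrictCompl (X ⊗ (dualProjectiveSpace N ℂ)) (Set.range (sliceAt X t).left.base) (2 * N' + 2)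
          (complexBetti.map (snd X (dualProjectiveSpace N ℂ)) (2 * N' + 2) ρ) = 0 := by
        rw [range_sliceAt_left_base]
        exact complexBetti.restrictCompl_map_eq_zero (snd X (dualProjectiveSpace N ℂ)) (restrictCompl_pt_eq_zero hP' (by omega) t ρ)
      obtain ⟨y, hy⟩ := exists_complexGysin_eq_of_isClosedImmersion μ hXP hX (sliceAt X t)
        (show 0 + 2 * (m + 1 + N) = (2 * N' + 2) + 2 * (m + 1) by omega) hρsupp
      obtain ⟨κ, rfl⟩ := singularCohomology.exists_eq_smul_one y
      exact ⟨κ, by rw [← hy, map_smul]⟩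
    -- the operator `L = Θ ∪ · − s_{t*} pr_{1*} (Θ ∪ ·)`
    have hAdeg : (2 * N' + 2 * p) + 2 * (m + 1) = 2 * (p - 1) + 2 * (m + 1 + N) := by omega
    have hKdeg : 2 * (p - 1) + 2 * (m + 1 + N) = (2 * N' + 2 * p) + 2 * (m + 1) := by omega
    let sA : complexBetti (X ⊗ (dualProjectiveSpace N ℂ)) (2 * N' + 2 * p) →ₗ[ℂ] complexBetti (X ⊗ (dualProjectiveSpace N ℂ)) (2 * N' + 2 * p) :=
      complexGysin μ hX hXP (sliceAt X t) hKdeg ∘ₗ complexGysin μ hXP hX (fst X (dualProjectiveSpace N ℂ)) hAdeg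
    let L : complexBetti (X ⊗ (dualProjectiveSpace N ℂ)) (2 * p) →ₗ[ℂ] complexBetti (X ⊗ (dualProjectiveSpace N ℂ)) (2 * N' + 2 * p) :=
      (LinearMap.id - sA) ∘ₗ cupProduct rfl Θ
    suffices hL : L δ = 0 by
      have h0 : cupProduct rfl Θ δ - sA (cupProduct rfl Θ δ) = 0 := hL
      exact sub_eq_zero.1 h0
    -- the Künneth generators with a factor of positive degree from `(dualProjectiveSpace N ℂ)`
    let S₁ : Submodule ℂ (complexBetti (X ⊗ (dualProjectiveSpace N ℂ)) (2 * p)) := Submodule.span ℂ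
      {v | ∃ (i j : ℕ) (h : i + j = 2 * p) (_ : 1 ≤ j) (a : complexBetti X i) (b : complexBetti (dualProjectiveSpace N ℂ) j),
        v = cupProduct h (complexBetti.map (fst X (dualProjectiveSpace N ℂ)) i a) (complexBetti.map (snd X (dualProjectiveSpace N ℂ)) j b)}
    haveI := pathConnectedSpace_complexPoints hP
    -- (1) every class is `fst^* a'` plus an element of `S₁` (Künneth spanning)
    have hsplit : ∀ z : complexBetti (X ⊗ (dualProjectiveSpace N ℂ)) (2 * p), ∃ a' : complexBetti X (2 * p),
        z - complexBetti.map (fst X (dualProjectiveSpace N ℂ)) (2 * p) a' ∈ S₁ := by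
      intro z
      refine Submodule.span_induction ?_ ?_ ?_ ?_ (kunnethSpan_complexBetti hX hP (2 * p) z)
      · rintro v ⟨i, j, h, a, b, rfl⟩
        by_cases hj : j = 0
        · subst hj
          obtain ⟨r, rfl⟩ := singularCohomology.exists_eq_smul_one b
          obtain rfl : i = 2 * p := by omega
          refine ⟨r • a, ?_⟩
          rw [map_smul, singularCohomology.map_one, map_smul, cupProduct_one, map_smul, sub_self]
          exact zero_mem _
        · refine ⟨0, ?_⟩
          rw [map_zero, sub_zero]
          exact Submodule.subset_span ⟨i, j, h, Nat.pos_of_ne_zero hj, a, b, rfl⟩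
      · exact ⟨0, by rw [map_zero, sub_zero]; exact zero_mem _⟩
      · rintro x y - - ⟨a₁, ha₁⟩ ⟨a₂, ha₂⟩
        refine ⟨a₁ + a₂, ?_⟩
        have := add_mem ha₁ ha₂
        rw [map_add]
        convert this using 1
        abel
      · rintro r x - ⟨a₁, ha₁⟩
        refine ⟨r • a₁, ?_⟩
        have := Submodule.smul_mem _ r ha₁
        rwa [smul_sub, ← map_smul] at this
    -- (2) `s_t^*` kills `S₁`
    have hkill : ∀ v ∈ S₁, complexBetti.map (sliceAt X t) (2 * p) v = 0 := by
      intro v hv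
      refine Submodule.span_induction ?_ (map_zero _) (fun x y _ _ hx hy ↦ by rw [map_add, hx, hy, add_zero])
        (fun r x _ hx ↦ by rw [map_smul, hx, smul_zero]) hv
      rintro _ ⟨i, j, h, hj, a, b, rfl⟩
      rw [cupProduct_map, map_sliceAt_map_snd_eq_zero X t (by omega) b, map_zero]
    -- hence `δ ∈ S₁`
    have hδS : δ ∈ S₁ := by
      obtain ⟨a', ha'⟩ := hsplit δ
      have h0 : a' = 0 := by
        have := hkill _ ha'
        rwa [map_sub, hδt, ← CategoryTheory.comp_apply, ← complexBetti.map_comp, sliceAt_fst, complexBetti.map_id,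
          CategoryTheory.id_apply, zero_sub, neg_eq_zero] at this
      rw [h0, map_zero, sub_zero] at ha'
      exact ha'
    -- (3) `L` kills the generators of `S₁`
    have hLgen : ∀ v ∈ S₁, L v = 0 := by
      intro v hv
      refine Submodule.span_induction ?_ (map_zero _) (fun x y _ _ hx hy ↦ by rw [map_add, hx, hy, add_zero])
        (fun r x _ hx ↦ by rw [map_smul, hx, smul_zero]) hv
      rintro _ ⟨i, j, h, hj, a, b, rfl⟩
      -- `Θ ∪ (fst^* a ∪ snd^* b) = fst^* a ∪ snd^* (θ ∪ b)`
      have e1 : cupProduct rfl Θ (cupProduct h (complexBetti.map (fst X (dualProjectiveSpace N ℂ)) i a) (complexBetti.map (snd X (dualProjectiveSpace N ℂ)) j b)) =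
          cupProduct (show i + (2 * N' + j) = 2 * N' + 2 * p by omega) (complexBetti.map (fst X (dualProjectiveSpace N ℂ)) i a)
            (complexBetti.map (snd X (dualProjectiveSpace N ℂ)) (2 * N' + j) (cupProduct rfl θ b)) := by
        rw [← cupProduct_assoc (show 2 * N' + i = 2 * N' + i from rfl) h (show (2 * N' + i) + j = 2 * N' + 2 * p by omega) rfl,
          cupProduct_gradedComm_holds ℂ (ComplexPoints (X ⊗ (dualProjectiveSpace N ℂ))) (show 2 * N' + i = 2 * N' + i from rfl)
            (show i + 2 * N' = 2 * N' + i by omega) Θ,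
          show ((-1 : ℂ) ^ (2 * N' * i)) = 1 by rw [show 2 * N' * i = 2 * (N' * i) by ring, pow_mul, neg_one_sq, one_pow],
          one_smul, cupProduct_assoc (show i + 2 * N' = 2 * N' + i by omega) (show 2 * N' + j = 2 * N' + j from rfl)
            (show (2 * N' + i) + j = 2 * N' + 2 * p by omega) (show i + (2 * N' + j) = 2 * N' + 2 * p by omega),
          hΘdef, ← cupProduct_map]
      change cupProduct rfl Θ _ - sA (cupProduct rfl Θ _) = 0
      rw [e1]
      rcases Nat.lt_or_ge 2 j with hj3 | hj2
      · -- `j ≥ 3`: `θ ∪ b ∈ H^{>2N}((dualProjectiveSpace N ℂ)) = 0`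
        haveI := subsingleton_complexBetti hP (k := 2 * N' + j) (by omega)
        rw [Subsingleton.elim (cupProduct rfl θ b) 0, map_zero, map_zero, map_zero, sub_zero]
      rcases Nat.lt_or_ge 1 j with hj2' | hj1
      · -- `j = 2`: `snd^* (θ ∪ b) = κ • s_{t*} 1`, so `fst^* a ∪ snd^*(θ ∪ b) = κ • s_{t*} a`
        obtain rfl : j = 2 := by omega
        obtain rfl : i = 2 * (p - 1) := by omega
        obtain ⟨κ, hκ⟩ := htop (cupProduct rfl θ b)
        have e2 : cupProduct (show 2 * (p - 1) + (2 * N' + 2) = 2 * N' + 2 * p by omega)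
            (complexBetti.map (fst X (dualProjectiveSpace N ℂ)) (2 * (p - 1)) a)
            (complexBetti.map (snd X (dualProjectiveSpace N ℂ)) (2 * N' + 2) (cupProduct rfl θ b)) =
            κ • complexGysin μ hX hXP (sliceAt X t) hKdeg a := by
          rw [hκ, map_smul, ← complexGysin_cup hμ hX hXP (sliceAt X t) (Nat.add_zero _)
            hKdeg _ _ (complexBetti.map (fst X (dualProjectiveSpace N ℂ)) (2 * (p - 1)) a),
            ← CategoryTheory.comp_apply, ← complexBetti.map_comp, sliceAt_fst, complexBetti.map_id,
            CategoryTheory.id_apply, cupProduct_one]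
        rw [e2, map_smul]
        change κ • _ - κ • complexGysin μ hX hXP (sliceAt X t) hKdeg (complexGysin μ hXP hX (fst X (dualProjectiveSpace N ℂ)) hAdeg _) = 0
        rw [hps hKdeg hAdeg, sub_self]
      · -- `j = 1`: `H¹((dualProjectiveSpace N ℂ)(ℂ); ℂ) = 0`
        obtain rfl : j = 1 := by omega
        haveI := subsingleton_complexBetti_projectiveSpace_one N
        rw [Subsingleton.elim b 0, map_zero, map_zero, map_zero, map_zero, sub_zero]
    exact hLgen δ hδS
  change complexGysin μ hXP hX (fst X (dualProjectiveSpace N ℂ)) hpr W = lam • c + cupProduct h9 (complexBetti.map (sliceAt X t) 2 Ycl) A₁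
  -- `W = (Θ ∪ ζt) ∪ [𝒴]`
  have hWx : W = cupProduct h1 (cupProduct rfl Θ ζt) Ycl := by
    rw [hWdef, hYcldef, ← complexGysin_cup hμ hY hXP emb (Nat.add_zero _)
      (show (2 * N' + 2 * p) + 2 * (m + 1 + N) = 2 * (N' + p + 1) + 2 * (m + N) by omega)
      (show 0 + 2 * (m + 1 + N) = 2 + 2 * (m + N) by omega) h1, cupProduct_one, cupProduct_map]
  have hζsplit : ζt = complexBetti.map (fst X (dualProjectiveSpace N ℂ)) (2 * p) c + δ := by rw [hδdef]; abel
  -- term A: `pr_{1*}((Θ ∪ pr₁^* c) ∪ [𝒴]) = c ∪ q_* f^* θ = lam • c`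
  have hprA : complexGysin μ hXP hX (fst X (dualProjectiveSpace N ℂ)) hpr
      (cupProduct h1 (cupProduct rfl Θ (complexBetti.map (fst X (dualProjectiveSpace N ℂ)) (2 * p) c)) Ycl) = lam • c := by
    have hcomm : cupProduct rfl Θ (complexBetti.map (fst X (dualProjectiveSpace N ℂ)) (2 * p) c) =
        cupProduct (show 2 * p + 2 * N' = 2 * N' + 2 * p by omega) (complexBetti.map (fst X (dualProjectiveSpace N ℂ)) (2 * p) c) Θ := by
      rw [cupProduct_gradedComm_holds ℂ (ComplexPoints (X ⊗ (dualProjectiveSpace N ℂ))) rfl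
        (show 2 * p + 2 * N' = 2 * N' + 2 * p by omega) Θ,
        show ((-1 : ℂ) ^ (2 * N' * (2 * p))) = 1 by
          rw [show 2 * N' * (2 * p) = 2 * (N' * (2 * p)) by ring, pow_mul, neg_one_sq, one_pow], one_smul]
    have hΘY : cupProduct rfl Θ Ycl = complexGysin μ hY hXP emb
        (show 2 * N' + 2 * (m + 1 + N) = (2 * N' + 2) + 2 * (m + N) by omega)
        (complexBetti.map emb (2 * N') Θ) := by
      rw [hYcldef, ← complexGysin_cup hμ hY hXP emb (Nat.add_zero _) _
        (show 0 + 2 * (m + 1 + N) = 2 + 2 * (m + N) by omega) rfl, cupProduct_one]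
    have h5 : 2 * N' + 2 * (m + 1 + N) = (2 * N' + 2) + 2 * (m + N) := by omega
    have h7 : (2 * N' + 2) + 2 * (m + 1) = 0 + 2 * (m + 1 + N) := by omega
    have hq : complexGysin μ hXP hX (fst X (dualProjectiveSpace N ℂ)) h7 (complexGysin μ hY hXP emb h5 (complexBetti.map emb (2 * N') Θ)) =
        complexGysin μ hY hX (emb ≫ fst X (dualProjectiveSpace N ℂ)) (show 2 * N' + 2 * (m + 1) = 0 + 2 * (m + N) by omega)
          (complexBetti.map (emb ≫ snd X (dualProjectiveSpace N ℂ)) (2 * N') θ) := by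
      rw [complexGysin_comp hμ hY hXP hX emb (fst X (dualProjectiveSpace N ℂ)) h5 h7, LinearMap.comp_apply, hΘdef,
        ← CategoryTheory.comp_apply, ← complexBetti.map_comp]
    rw [hcomm, cupProduct_assoc _ (show 2 * N' + 2 = 2 * N' + 2 from rfl) h1
      (show 2 * p + (2 * N' + 2) = 2 * (N' + p + 1) by omega), hΘY,
      complexGysin_cup hμ hXP hX (fst X (dualProjectiveSpace N ℂ)) _ hpr h7 (Nat.add_zero _), hq, hlam, map_smul, cupProduct_one]
  -- term B: `pr_{1*}((Θ ∪ δ) ∪ [𝒴]) = pr_{1*}(s_{t*}(s_t^*[𝒴] ∪ A₁)) = s_t^*[𝒴] ∪ A₁`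
  have hprB : complexGysin μ hXP hX (fst X (dualProjectiveSpace N ℂ)) hpr (cupProduct h1 (cupProduct rfl Θ δ) Ycl) =
      cupProduct h9 (complexBetti.map (sliceAt X t) 2 Ycl) A₁ := by
    rw [hK, cupProduct_gradedComm_holds ℂ (ComplexPoints (X ⊗ (dualProjectiveSpace N ℂ))) h1 h1' _ Ycl,
      show ((-1 : ℂ) ^ ((2 * N' + 2 * p) * 2)) = 1 by
        rw [pow_mul, show (2 * N' + 2 * p) = 2 * (N' + p) by ring, pow_mul, neg_one_sq, one_pow, one_pow],
      one_smul, ← complexGysin_cup hμ hX hXP (sliceAt X t) h9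
        (show 2 * p + 2 * (m + 1 + N) = 2 * (N' + p + 1) + 2 * (m + 1) by omega) _ h1' Ycl A₁,
      ← LinearMap.comp_apply, ← complexGysin_comp hμ hX hXP hX (sliceAt X t) (fst X (dualProjectiveSpace N ℂ))]
    simp only [sliceAt_fst]
    rw [complexGysin_id hμ hX, LinearMap.id_apply]
  rw [hWx, hζsplit, map_add (cupProduct rfl Θ), map_add (cupProduct h1), LinearMap.add_apply, map_add,
    hprA, hprB]

end Summit.HodgeConjecture.HodgeConjecture.Theorems

end
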